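import Literature.AlgebraicGeometry.Motives.CurveLinearSystemMaps
import Literature.AlgebraicGeometry.RelativeSpec.TransitionAtlasGluing
import HarnessLib

/-!
# Weil's construction of the Jacobian, I: the glued scheme `J` and its separatedness

Let `K` be an algebraically closed field of characteristic `0`, `C` a smooth projective
geometrically integral curve over `K` with a `K`-point datum `hX`, `g` an integer with
`genus ≤ g`, `C⁽ᵍ⁾ = symPowProj C hC g` the symmetric power and `W ⊆ C⁽ᵍ⁾` the open of effective
divisors `E` of degree `g` with `ℓ(E) = 1` (`chartWOpens`, Milne §5). Following Weil (Milne,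
*Jacobian Varieties*, §7, proof of Thm. 7.1) we construct the Jacobian `J` as a `K`-scheme by
GLUING copies `W_R` of `W`, one for every `g`-tuple `R` of `K`-points of `C`; the copy `W_R`
is to be thought of as the set of divisor classes `{[E − Σ[R]] : E ∈ W}` of degree `0`.

* `WeilJacobian.V R R' ⊆ W` is the open `{E ∈ W : ℓ(Ê(E) − Σ[R] + Σ[R']) ≤ 1}` (semicontinuity,
  `Motives/CurveLinearSystemOpens`), on which, by Riemann's inequality, `ℓ = 1`;
* `WeilJacobian.transPK R R' : V R R' → C⁽ᵍ⁾` is the MORPHISM `E ↦ E'`, `E'` the unique effective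
  divisor with `E' ∼ E − Σ[R] + Σ[R']` (the master theorem `exists_hom_translate` of
  `Motives/CurveLinearSystemMaps`, i.e. the closed-graph theorem over the normal variety `W`); it
  lands in `W` and gives the transition map `WeilJacobian.trans R R' : V R R' → W`
  (`transPK_spec`, `liftDiv_transPK`);
* the five atlas axioms (`V_self`, `trans_self`, `trans_mem`, `trans_dom`, `trans_cocycle`) are
  checked on `K`-points (`K`-points are dense and the schemes are reduced and separated:
  `SchemeOver.hom_ext_of_forall_algPoints`, `Opens.le_of_forall_pt_mem`), where they are divisor
  class bookkeeping plus the uniqueness `ℓ(Ê(E')) = 1`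
  (`symPowProj.algPoints_eq_of_isLinearlyEquivalent`);
* `WeilJacobian.atlas` is the resulting `TransitionAtlas` on `W` (`RelativeSpec/TransitionAtlasGluing`),
  `WeilJacobian.J = atlas.glued` the glued scheme, `WeilJacobian.JK` the `K`-scheme and
  `WeilJacobian.chart R : W ↪ J` the open charts; `J` is reduced and locally of finite type over `K`,
  every `K`-point of `J` is a chart point (`exists_comp_chart_eq`), and two chart points
  `[E − Σ[R]]`, `[E' − Σ[R']]` coincide iff `Ê(E) − Σ[R] ∼ Ê(E') − Σ[R']` (`comp_chart_eq_iff`) — so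
  `J(K)` is in bijection with the classes `ξ` of degree `0` with `ℓ(ξ + Σ[R]) = 1`-representable for
  some `R`, i.e. (every class of degree `g` being effective) with `Pic⁰(C)`;
* `J` is SEPARATED over `K` (`isSeparated_Jbase`): by `TransitionAtlas.isSeparated_toBase` it
  suffices that the graph of each `t_{R,R'}` is closed in `W ×_K W`; it is locally closed (a closed
  immersion into `V R R' ×_K W` followed by an open immersion, `graph_eq`), the set
  `{(E, E') : ℓ(Ê(E) − Ê(E') − Σ[R] + Σ[R']) ≥ 1}` is closed (semicontinuity for mixed signs,
  `exists_opens_tensor_symPowProj_pt_mem_iff_sub`) with the same `K`-points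
  (`exists_comp_graphK_eq_iff`), and in a Jacobson space a locally closed set and a closed set with
  the same closed points are equal (`eq_of_isLocallyClosed_of_isClosed_of_closedPoints`).

The group law, the map `Cᵍ → J`, properness and the dimension count are in the sequel files
(`Motives/WeilJacobianSymmetrize`, …). Technical note: the `K`-schemes `WK`, `VK`, `JK` are built
with `overMk` (the structure literal behind `Over.mk`) so that `.left`/`.hom` reduce at reducible
transparency.

Mathlib searched (pin): `Scheme.Hom.isoImage`, `IsOpenImmersion.lift`, `MorphismProperty.pullbackMap`,
the closed-immersion instance for `pullback.lift (𝟙 _) f _` under `[IsSeparated g]`,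
`JacobsonSpace.closure_inter_closedPoints_eq_closure`, `nonempty_inter_closedPoints`,
`LocallyOfFiniteType.jacobsonSpace`, `Over.lift_left` (all used); Mathlib has no Jacobians and no
gluing of schemes along a locally-directed atlas beyond `Scheme.GlueData` (the tree's
`TransitionAtlas` is used instead).

## References

* J. S. Milne, *Jacobian Varieties*, in Cornell–Silverman (eds.), *Arithmetic Geometry* (1986),
  §5 (the open `W ⊆ C⁽ᵍ⁾`, Thm. 5.1 (a)) and §7 (Weil's construction of the Jacobian, Thm. 7.1).
  [Milne1986JacobianVarieties]
* A. Weil, *Variétés abéliennes et courbes algébriques*, Hermann (1948). [Weil1948VarietesAbeliennes]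
-/

noncomputable section

universe u

open CategoryTheory CategoryTheory.Limits AlgebraicGeometry MonoidalCategory CartesianMonoidalCategory
  TopologicalSpace
open Literature.NumberTheory.DiophantineGeometry
open Literature.NumberTheory.DiophantineGeometry.AlgFunctionField
open Literature.AlgebraicGeometry.RelativeSpec

namespace Literature.AlgebraicGeometry.Motives

open RatFn FieldPoint CartierDivisor CurvePlaces

/-! ### Linear equivalence bookkeeping -/

section LinEq

variable {K : Type*} {F : Type*} [Field K] [Field F] [Algebra K F] [IsAlgFunctionField K F]

/-- `D ∼ D` . [folklore] -/
theorem Divisor.IsLinearlyEquivalent.refl' (D : Divisor K F) : D.IsLinearlyEquivalent D := by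
  change (D - D).IsPrincipal
  rw [sub_self]
  exact ⟨1, one_ne_zero, principalDivisor_one (K := K) (F := F)⟩

omit [IsAlgFunctionField K F] in
/-- `D ∼ D' ⟹ D + c ∼ D' + c`. [folklore] -/
theorem Divisor.IsLinearlyEquivalent.add_right' {D D' : Divisor K F} (h : D.IsLinearlyEquivalent D')
    (c : Divisor K F) : (D + c).IsLinearlyEquivalent (D' + c) := by
  change (D + c - (D' + c)).IsPrincipal
  rwa [add_sub_add_right_eq_sub]

/-- `D = D' ⟹ D ∼ D'`. [folklore] -/
theorem Divisor.IsLinearlyEquivalent.of_eq' {D D' : Divisor K F} (h : D = D') : D.IsLinearlyEquivalent D' :=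
  h ▸ Divisor.IsLinearlyEquivalent.refl' D

omit [IsAlgFunctionField K F] in
/-- Linearly equivalent divisors have the same `ℓ`. [folklore] -/
theorem Divisor.IsLinearlyEquivalent.ell_eq {D D' : Divisor K F} (h : D.IsLinearlyEquivalent D') :
    ell D = ell D' :=
  ell_congr_of_isLinearlyEquivalent_holds h

end LinEq

/-! ### `K`-points through open immersions -/

section OpenImm

variable {K : Type u} [Field K] {X Y : SchemeOver K}

/-- **A `K`-point in the image of an open immersion lifts along it.** [folklore] -/
theorem AlgPoints.exists_comp_eq_of_mem_range (f : X ⟶ Y) [IsOpenImmersion f.left] (z : AlgPoints Y K)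
    (hz : z.pt ∈ Set.range f.left) : ∃ x : AlgPoints X K, x ≫ f = z := by
  haveI : Subsingleton ↥(specOver K K).left := inferInstanceAs (Subsingleton (PrimeSpectrum K))
  have hr : Set.range z.left ⊆ Set.range f.left := by
    rintro _ ⟨p, rfl⟩
    rw [Subsingleton.elim p (IsLocalRing.closedPoint K)]
    exact hz
  refine ⟨Over.homMk (IsOpenImmersion.lift f.left z.left hr) ?_, ?_⟩
  · rw [← Over.w f, ← Category.assoc, IsOpenImmersion.lift_fac]
    exact Over.w z
  · ext : 1
    exact IsOpenImmersion.lift_fac _ _ _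

/-- `K`-points with the same image under a morphism injective on points are equal. [folklore] -/
theorem AlgPoints.eq_of_comp_eq [IsAlgClosed K] [LocallyOfFiniteType X.hom] (f : X ⟶ Y)
    (hf : Function.Injective f.left) {x x' : AlgPoints X K} (h : x ≫ f = x' ≫ f) : x = x' := by
  apply AlgPoints.eq_of_pt_eq
  apply hf
  rw [← AlgPoints.pt_comp, ← AlgPoints.pt_comp, h]

end OpenImm


section OverMk

/-- `Over.mk` as a structure literal, so that `.left` and `.hom` reduce at reducible transparency
(instance synthesis and `rw` then see through the `K`-scheme wrappers below). [folklore] -/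
abbrev overMk {S Y : Scheme.{u}} (f : Y ⟶ S) : Over S := ⟨Y, ⟨⟨⟩⟩, f⟩

/-- `overMk f = Over.mk f`. [folklore] -/
theorem overMk_eq {S Y : Scheme.{u}} (f : Y ⟶ S) : overMk f = Over.mk f := rfl

end OverMk

/-! ### A Jacobson lemma: locally closed sets are determined by their closed points -/

/-- **In a Jacobson space a locally closed set and a closed set with the same closed points are
equal.** [folklore] -/
theorem eq_of_isLocallyClosed_of_isClosed_of_closedPoints {X : Type*} [TopologicalSpace X] [JacobsonSpace X]
    {L M : Set X} (hL : IsLocallyClosed L) (hM : IsClosed M)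
    (h : ∀ x, IsClosed ({x} : Set X) → (x ∈ L ↔ x ∈ M)) : L = M := by
  have hint : L ∩ closedPoints X = M ∩ closedPoints X := by
    ext x
    simp only [Set.mem_inter_iff, mem_closedPoints_iff]
    exact ⟨fun ⟨hx, hc⟩ ↦ ⟨(h x hc).1 hx, hc⟩, fun ⟨hx, hc⟩ ↦ ⟨(h x hc).2 hx, hc⟩⟩
  have hcl : closure L = M := by
    rw [← JacobsonSpace.closure_inter_closedPoints_eq_closure hL, hint,
      JacobsonSpace.closure_inter_closedPoints_eq_closure hM.isLocallyClosed, hM.closure_eq]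
  obtain ⟨U, Z, hU, hZ, rfl⟩ := hL
  apply le_antisymm
  · rw [← hcl]; exact subset_closure
  · intro x hx
    have hxZ : x ∈ Z := by
      have : M ⊆ Z := by rw [← hcl]; exact closure_minimal Set.inter_subset_right hZ
      exact this hx
    by_contra hxL
    have hxU : x ∉ U := fun hxU ↦ hxL ⟨hxU, hxZ⟩
    -- the closed set `M ∩ Uᶜ` has no closed points, hence is empty
    obtain ⟨y, ⟨hyM, hyU⟩, hycl⟩ := nonempty_inter_closedPoints (Z := M ∩ Uᶜ) ⟨x, hx, hxU⟩
      (hM.inter hU.isClosed_compl).isLocallyClosed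
    exact hyU ((h y (mem_closedPoints_iff.mp hycl)).2 hyM).1

/-- The image of a closed set under an open embedding is locally closed. [folklore] -/
theorem isLocallyClosed_image_of_isOpenEmbedding {X Y : Type*} [TopologicalSpace X] [TopologicalSpace Y]
    {f : X → Y} (hf : Topology.IsOpenEmbedding f) {Z : Set X} (hZ : IsClosed Z) : IsLocallyClosed (f '' Z) := by
  refine ⟨Set.range f, (f '' Zᶜ)ᶜ, hf.isOpen_range, (hf.isOpenMap _ hZ.isOpen_compl).isClosed_compl, ?_⟩
  ext y
  constructor
  · rintro ⟨x, hx, rfl⟩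
    refine ⟨⟨x, rfl⟩, fun ⟨x', hx', he⟩ ↦ hx' ?_⟩
    rwa [hf.injective he]
  · rintro ⟨⟨x, rfl⟩, hy⟩
    exact ⟨x, by_contra fun hx ↦ hy ⟨x, hx, rfl⟩, rfl⟩


/-! ### The chart `W`, the opens `V R R'` and the transition maps -/

namespace WeilJacobian

variable {K : Type u} [Field K] [IsAlgClosed K] [CharZero K]
  (C : SchemeOver K) [IsIntegral C.left] [SmoothOfRelativeDimension 1 C.hom] [IsProper C.hom]
  [GeometricallyIntegral C.hom] (hC : IsProjectiveOver C) (hX : CechPseudoCoherentAt C) (g : ℕ)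
  (hg : (genus K (curveBC C (strPt (K := K) K)).left.functionField : ℤ) ≤ g)

/-- **The chart `W = {E ∈ C⁽ᵍ⁾ : ℓ(E) = 1}` as a `K`-scheme.** [cite: Milne1986JacobianVarieties, §5 (proof of Thm. 5.1 (a)) and §7] -/
abbrev WK : SchemeOver K := overMk ((chartWOpens C g hC hX).ι ≫ (symPowProj C hC g).hom)

/-- The open immersion `W ↪ C⁽ᵍ⁾` over `K`. [folklore] -/
abbrev ιW : WK C hC hX g ⟶ symPowProj C hC g := Over.homMk (chartWOpens C g hC hX).ι rfl

/-- `W → Spec K` is locally of finite type. [folklore] -/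
instance locallyOfFiniteType_WK_hom : LocallyOfFiniteType (WK C hC hX g).hom := by
  haveI := symPowProj.locallyOfFiniteType_hom C hC g
  show LocallyOfFiniteType ((chartWOpens C g hC hX).ι ≫ (symPowProj C hC g).hom)
  infer_instance

/-- `W → Spec K` is separated. [folklore] -/
instance isSeparated_WK_hom : IsSeparated (WK C hC hX g).hom := by
  haveI := symPowProj.isProper_hom C hC g
  show IsSeparated ((chartWOpens C g hC hX).ι ≫ (symPowProj C hC g).hom)
  infer_instance

/-- `W` is reduced. [folklore] -/
instance isReduced_WK_left : IsReduced (WK C hC hX g).left := by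
  haveI := symPowProj.isIntegral_left C hC g
  show IsReduced (chartWOpens C g hC hX : Scheme.{u})
  infer_instance

/-- `ιW` is an open immersion. [folklore] -/
instance isOpenImmersion_ιW_left : IsOpenImmersion (ιW C hC hX g).left :=
  inferInstanceAs (IsOpenImmersion (chartWOpens C g hC hX).ι)

omit [IsAlgClosed K] [CharZero K] in
/-- A `K`-point of `W`, seen in `C⁽ᵍ⁾`, lies in `W`. [folklore] -/
theorem pt_comp_ιW_mem (x : AlgPoints (WK C hC hX g) K) : AlgPoints.pt (x ≫ ιW C hC hX g) ∈ chartW C g hC := by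
  rw [AlgPoints.pt_comp]
  exact (x.pt : chartWOpens C g hC hX).2

omit [CharZero K] in
/-- **`ℓ(Ê(E)) = 1` for a `K`-point `E` of `W`.** [folklore] -/
theorem ell_liftDiv_comp_ιW (x : AlgPoints (WK C hC hX g) K) : ell (liftDiv C g hC (x ≫ ιW C hC hX g)) = 1 :=
  (pt_mem_chartW_iff C g hC _).mp (pt_comp_ιW_mem C hC hX g x)

omit [CharZero K] in
/-- `x ↦ x ≫ ιW` is injective on `K`-points. [folklore] -/
theorem comp_ιW_injective : Function.Injective fun x : AlgPoints (WK C hC hX g) K ↦ x ≫ ιW C hC hX g :=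
  fun _ _ h ↦ AlgPoints.eq_of_comp_eq (ιW C hC hX g) (chartWOpens C g hC hX).ι.isOpenEmbedding.injective h

omit [IsAlgClosed K] [CharZero K] in
/-- A `K`-point of `C⁽ᵍ⁾` in `W` is a `K`-point of `W`. [folklore] -/
theorem exists_comp_ιW_eq (y : AlgPoints (symPowProj C hC g) K) (hy : y.pt ∈ chartW C g hC) :
    ∃ x : AlgPoints (WK C hC hX g) K, x ≫ ιW C hC hX g = y :=
  AlgPoints.exists_comp_eq_of_mem_range (ιW C hC hX g) y (by
    show y.pt ∈ Set.range (chartWOpens C g hC hX).ι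
    rwa [Scheme.Opens.range_ι])

/-- **The open `U_{R,R'} = {y : ℓ(Ê(y) − Σ[R] + Σ[R']) ≤ 1}` of `C⁽ᵍ⁾`** (semicontinuity). [folklore] -/
def transOpens (R R' : Fin g → AlgPoints C K) : (symPowProj C hC g).left.Opens :=
  opensOfAlgPoints (symPowProj C hC g) fun y ↦ ell (liftDiv C g hC y + tupleDiv C R' - tupleDiv C R) ≤ 1

omit [CharZero K] in
include hX in
/-- `K`-points of `U_{R,R'}`. [folklore] -/
theorem pt_mem_transOpens_iff (R R' : Fin g → AlgPoints C K) (y : AlgPoints (symPowProj C hC g) K) :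
    y.pt ∈ transOpens C hC g R R' ↔ ell (liftDiv C g hC y + tupleDiv C R' - tupleDiv C R) ≤ 1 := by
  refine pt_mem_opensOfAlgPoints_iff ?_ y
  obtain ⟨U, hU⟩ := exists_opens_symPowProj_pt_mem_iff C hX g hC 1 R' R
  refine ⟨U, fun z ↦ ?_⟩
  obtain ⟨R₀, hR₀⟩ := exists_tuplePt_mk_eq C g hC z
  rw [← hR₀, hU, liftDiv_tuplePt_mk]

/-- **The open `V R R' = W ∩ U_{R,R'}` of the chart `W`** on which the transition to chart `R'` is
defined. [cite: Milne1986JacobianVarieties, §7 (proof of Thm. 7.1)] -/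
abbrev V (R R' : Fin g → AlgPoints C K) : (WK C hC hX g).left.Opens :=
  (chartWOpens C g hC hX).ι ⁻¹ᵁ transOpens C hC g R R'

omit [CharZero K] in
/-- `K`-points of `V R R'`: `ℓ(Ê(E) − Σ[R] + Σ[R']) ≤ 1`. [folklore] -/
theorem pt_mem_V_iff (R R' : Fin g → AlgPoints C K) (x : AlgPoints (WK C hC hX g) K) :
    x.pt ∈ V C hC hX g R R' ↔ ell (liftDiv C g hC (x ≫ ιW C hC hX g) + tupleDiv C R' - tupleDiv C R) ≤ 1 := by
  rw [← pt_mem_transOpens_iff C hC hX g R R', AlgPoints.pt_comp]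
  rfl

omit [CharZero K] in
include hg in
/-- On `V R R'`: `ℓ(Ê(E) − Σ[R] + Σ[R']) = 1` (Riemann: `ℓ ≥ deg + 1 − g = 1`). [folklore] -/
theorem ell_eq_one_of_pt_mem_V (R R' : Fin g → AlgPoints C K) (x : AlgPoints (WK C hC hX g) K)
    (hx : x.pt ∈ V C hC hX g R R') :
    ell (liftDiv C g hC (x ≫ ιW C hC hX g) + tupleDiv C R' - tupleDiv C R) = 1 := by
  refine le_antisymm ((pt_mem_V_iff C hC hX g R R' x).mp hx) (one_le_ell_of_degree_eq C g hg ?_)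
  rw [map_sub, map_add, degree_liftDiv, degree_tupleDiv, degree_tupleDiv]
  ring

/-- `V R R'` as a `K`-scheme. [folklore] -/
abbrev VK (R R' : Fin g → AlgPoints C K) : SchemeOver K :=
  overMk ((V C hC hX g R R').ι ≫ (WK C hC hX g).hom)

/-- The inclusion `V R R' ↪ W` over `K`. [folklore] -/
abbrev ιV (R R' : Fin g → AlgPoints C K) : VK C hC hX g R R' ⟶ WK C hC hX g :=
  Over.homMk (V C hC hX g R R').ι rfl

/-- `V R R' → Spec K` is locally of finite type. [folklore] -/
instance locallyOfFiniteType_VK_hom (R R' : Fin g → AlgPoints C K) :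
    LocallyOfFiniteType (VK C hC hX g R R').hom := by
  show LocallyOfFiniteType ((V C hC hX g R R').ι ≫ (WK C hC hX g).hom)
  infer_instance

/-- `V R R'` is reduced. [folklore] -/
instance isReduced_VK_left (R R' : Fin g → AlgPoints C K) : IsReduced (VK C hC hX g R R').left := by
  show IsReduced (V C hC hX g R R' : Scheme.{u})
  infer_instance

/-- `ιV` is an open immersion. [folklore] -/
instance isOpenImmersion_ιV_left (R R' : Fin g → AlgPoints C K) : IsOpenImmersion (ιV C hC hX g R R').left :=
  inferInstanceAs (IsOpenImmersion (V C hC hX g R R').ι)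

omit [CharZero K] in
/-- A `K`-point of `V R R'`, seen in `W`, lies in `V R R'`. [folklore] -/
theorem pt_comp_ιV_mem (R R' : Fin g → AlgPoints C K) (x : AlgPoints (VK C hC hX g R R') K) :
    AlgPoints.pt (x ≫ ιV C hC hX g R R') ∈ V C hC hX g R R' := by
  rw [AlgPoints.pt_comp]
  exact (x.pt : V C hC hX g R R').2

omit [CharZero K] in
/-- A `K`-point of `W` in `V R R'` is a `K`-point of `V R R'`. [folklore] -/
theorem exists_comp_ιV_eq (R R' : Fin g → AlgPoints C K) (x : AlgPoints (WK C hC hX g) K)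
    (hx : x.pt ∈ V C hC hX g R R') : ∃ x' : AlgPoints (VK C hC hX g R R') K, x' ≫ ιV C hC hX g R R' = x :=
  AlgPoints.exists_comp_eq_of_mem_range (ιV C hC hX g R R') x (by
    show x.pt ∈ Set.range (V C hC hX g R R').ι
    rwa [Scheme.Opens.range_ι])

omit [CharZero K] in
/-- The point of the lift of a `K`-point of `W` in `V R R'`. [folklore] -/
theorem pt_eq_of_comp_ιV_eq (R R' : Fin g → AlgPoints C K) {x : AlgPoints (WK C hC hX g) K}
    {x' : AlgPoints (VK C hC hX g R R') K} (h : x' ≫ ιV C hC hX g R R' = x) (hx : x.pt ∈ V C hC hX g R R') :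
    x'.pt = ⟨x.pt, hx⟩ := by
  apply (V C hC hX g R R').ι.isOpenEmbedding.injective
  change (ιV C hC hX g R R').left x'.pt = x.pt
  rw [← AlgPoints.pt_comp, h]

/-! ### The transition morphisms `t_{R,R'} : V R R' → W` -/

/-- The open `W.ι(V R R') = W ∩ U_{R,R'}` of `C⁽ᵍ⁾`, on which the master theorem is applied. [folklore] -/
abbrev transΩ (R R' : Fin g → AlgPoints C K) : (symPowProj C hC g).left.Opens :=
  (chartWOpens C g hC hX).ι ''ᵁ V C hC hX g R R'

omit [CharZero K] in
/-- `W.ι(V R R') = W ∩ U_{R,R'}`. [folklore] -/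
theorem transΩ_eq (R R' : Fin g → AlgPoints C K) :
    transΩ C hC hX g R R' = chartWOpens C g hC hX ⊓ transOpens C hC g R R' := by
  show (chartWOpens C g hC hX).ι ''ᵁ ((chartWOpens C g hC hX).ι ⁻¹ᵁ transOpens C hC g R R') = _
  rw [Scheme.Hom.image_preimage_eq_opensRange_inf, Scheme.Opens.opensRange_ι]

omit [CharZero K] in
include hg in
/-- On `K`-points of `W ∩ U_{R,R'}`: `ℓ(Ê(y) − Σ[R] + Σ[R']) = 1`. [folklore] -/
theorem ell_eq_one_of_pt_mem_transΩ (R R' : Fin g → AlgPoints C K) (y : AlgPoints (symPowProj C hC g) K)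
    (hy : y.pt ∈ transΩ C hC hX g R R') :
    ell (liftDiv C g hC y + tupleDiv C R' - tupleDiv C R) = 1 := by
  rw [transΩ_eq] at hy
  refine le_antisymm ((pt_mem_transOpens_iff C hC hX g R R' y).mp hy.2) (one_le_ell_of_degree_eq C g hg ?_)
  rw [map_sub, map_add, degree_liftDiv, degree_tupleDiv, degree_tupleDiv]
  ring

/-- The source `K`-scheme of the master theorem on `W ∩ U_{R,R'}` (stated with `Over.mk`, as the
master theorem is). [folklore] -/
abbrev ΩK (R R' : Fin g → AlgPoints C K) : SchemeOver K :=
  Over.mk ((transΩ C hC hX g R R').ι ≫ (symPowProj C hC g).hom)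

include hg in
/-- The master theorem on `W ∩ U_{R,R'}` (when non-empty): a morphism `E ↦ E' ∼ E − Σ[R] + Σ[R']`. [cite: Milne1986JacobianVarieties, §7 (Weil's construction)] -/
theorem exists_transHom (R R' : Fin g → AlgPoints C K)
    (h : (transΩ C hC hX g R R' : Set (symPowProj C hC g).left).Nonempty) :
    ∃ ψ : ΩK C hC hX g R R' ⟶ symPowProj C hC g,
      ∀ (t : AlgPoints (ΩK C hC hX g R R') K) (R₀ : Fin g → AlgPoints C K),
        Divisor.IsLinearlyEquivalent (tupleDiv C R₀)
          (liftDiv C g hC (t ≫ Over.homMk (transΩ C hC hX g R R').ι rfl) + tupleDiv C R' - tupleDiv C R) →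
        t ≫ ψ = tuplePt C (strPt (K := K) K) R₀ ≫ symPowProj.mk C hC g :=
  exists_hom_translate C hC hX g hg R' R rfl (transΩ C hC hX g R R') h
    (ell_eq_one_of_pt_mem_transΩ C hC hX g hg R R')

/-- `V R R' ≅ W.ι(V R R')` over `K`. [folklore] -/
def isoVΩ (R R' : Fin g → AlgPoints C K) : VK C hC hX g R R' ≅ ΩK C hC hX g R R' :=
  Over.isoMk ((chartWOpens C g hC hX).ι.isoImage (V C hC hX g R R')) (by
    show ((chartWOpens C g hC hX).ι.isoImage (V C hC hX g R R')).hom ≫ (transΩ C hC hX g R R').ι ≫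
      (symPowProj C hC g).hom = (V C hC hX g R R').ι ≫ (chartWOpens C g hC hX).ι ≫ (symPowProj C hC g).hom
    rw [Scheme.Hom.isoImage_hom_ι_assoc])

omit [CharZero K] in
/-- `isoVΩ` followed by the inclusion of `W.ι(V R R')` is `ιV ≫ ιW`. [folklore] -/
@[reassoc]
theorem isoVΩ_hom_ι (R R' : Fin g → AlgPoints C K) :
    (isoVΩ C hC hX g R R').hom ≫ (Over.homMk (transΩ C hC hX g R R').ι rfl : ΩK C hC hX g R R' ⟶ symPowProj C hC g) =
      ιV C hC hX g R R' ≫ ιW C hC hX g := by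
  ext : 1
  show ((chartWOpens C g hC hX).ι.isoImage (V C hC hX g R R')).hom ≫ (transΩ C hC hX g R R').ι =
    (V C hC hX g R R').ι ≫ (chartWOpens C g hC hX).ι
  rw [Scheme.Hom.isoImage_hom_ι]

open Classical in
/-- **The transition map into `C⁽ᵍ⁾` over `K`**: `V R R' → C⁽ᵍ⁾`, `E ↦ E' ∼ E − Σ[R] + Σ[R']` (the
morphism of `exists_transHom` transported to `V R R'`; the inclusion if `V R R' = ∅`). [cite: Milne1986JacobianVarieties, §7 (Weil's construction)] -/
def transPK (R R' : Fin g → AlgPoints C K) : VK C hC hX g R R' ⟶ symPowProj C hC g :=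
  if h : (transΩ C hC hX g R R' : Set (symPowProj C hC g).left).Nonempty then
    (isoVΩ C hC hX g R R').hom ≫ Classical.choose (exists_transHom C hC hX g hg R R' h)
  else ιV C hC hX g R R' ≫ ιW C hC hX g

/-- **The defining property of the transition map on `K`-points**: `E ↦` the `K`-point of `C⁽ᵍ⁾`
of any tuple `R₀` with `Σ[R₀] ∼ Ê(E) − Σ[R] + Σ[R']`. [cite: Milne1986JacobianVarieties, §7 (Weil's construction)] -/
theorem transPK_spec (R R' : Fin g → AlgPoints C K) (x : AlgPoints (VK C hC hX g R R') K)
    (R₀ : Fin g → AlgPoints C K)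
    (h : Divisor.IsLinearlyEquivalent (tupleDiv C R₀)
      (liftDiv C g hC (x ≫ ιV C hC hX g R R' ≫ ιW C hC hX g) + tupleDiv C R' - tupleDiv C R)) :
    x ≫ transPK C hC hX g hg R R' = tuplePt C (strPt (K := K) K) R₀ ≫ symPowProj.mk C hC g := by
  have hne : (transΩ C hC hX g R R' : Set (symPowProj C hC g).left).Nonempty :=
    ⟨(chartWOpens C g hC hX).ι (x.pt : V C hC hX g R R').1, ⟨_, (x.pt : V C hC hX g R R').2, rfl⟩⟩
  have hψ := Classical.choose_spec (exists_transHom C hC hX g hg R R' hne) (x ≫ (isoVΩ C hC hX g R R').hom) R₀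
    (by rw [Category.assoc, isoVΩ_hom_ι]; exact h)
  have e : transPK C hC hX g hg R R' = (isoVΩ C hC hX g R R').hom ≫ Classical.choose (exists_transHom C hC hX g hg R R' hne) :=
    dif_pos hne
  rw [e, ← Category.assoc]
  exact hψ

include hg in
/-- **`Ê(t E) ∼ Ê(E) − Σ[R] + Σ[R']` and `ℓ(Ê(t E)) = 1`** for a `K`-point `E` of `V R R'`. [cite: Milne1986JacobianVarieties, §7 (Weil's construction)] -/
theorem liftDiv_transPK (R R' : Fin g → AlgPoints C K) (x : AlgPoints (VK C hC hX g R R') K) :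
    (liftDiv C g hC (x ≫ transPK C hC hX g hg R R')).IsLinearlyEquivalent
        (liftDiv C g hC (x ≫ ιV C hC hX g R R' ≫ ιW C hC hX g) + tupleDiv C R' - tupleDiv C R) ∧
      ell (liftDiv C g hC (x ≫ transPK C hC hX g hg R R')) = 1 := by
  have hdeg : (liftDiv C g hC (x ≫ ιV C hC hX g R R' ≫ ιW C hC hX g) + tupleDiv C R' - tupleDiv C R).degree = g := by
    rw [map_sub, map_add, degree_liftDiv, degree_tupleDiv, degree_tupleDiv]; ring
  obtain ⟨R₀, hR₀⟩ := exists_tuple_isLinearlyEquivalent C hdeg hg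
  replace hR₀ : (tupleDiv C R₀).IsLinearlyEquivalent
      (liftDiv C g hC (x ≫ ιV C hC hX g R R' ≫ ιW C hC hX g) + tupleDiv C R' - tupleDiv C R) := hR₀
  rw [transPK_spec C hC hX g hg R R' x R₀ hR₀, liftDiv_tuplePt_mk]
  refine ⟨hR₀, ?_⟩
  rw [Divisor.IsLinearlyEquivalent.ell_eq hR₀]
  have := ell_eq_one_of_pt_mem_V C hC hX g hg R R' _ (pt_comp_ιV_mem C hC hX g R R' x)
  rwa [Category.assoc] at this

include hg in
/-- The transition map lands in `W` (on `K`-points). [folklore] -/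
theorem pt_transPK_mem_chartW (R R' : Fin g → AlgPoints C K) (x : AlgPoints (VK C hC hX g R R') K) :
    AlgPoints.pt (x ≫ transPK C hC hX g hg R R') ∈ chartW C g hC :=
  (pt_mem_chartW_iff C g hC _).mpr (liftDiv_transPK C hC hX g hg R R' x).2

include hg in
/-- The transition map lands in `W` (on all points). [folklore] -/
theorem range_transPK_subset (R R' : Fin g → AlgPoints C K) :
    Set.range (transPK C hC hX g hg R R').left ⊆ Set.range (chartWOpens C g hC hX).ι := by
  rw [Scheme.Opens.range_ι]
  rintro _ ⟨p, rfl⟩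
  exact forall_mem_of_forall_pt_mem (transPK C hC hX g hg R R') (isOpen_chartW C g hC hX)
    (pt_transPK_mem_chartW C hC hX g hg R R') p

/-- **The transition map `t_{R,R'} : V R R' → W`.** [cite: Milne1986JacobianVarieties, §7 (Weil's construction)] -/
def trans (R R' : Fin g → AlgPoints C K) : (V C hC hX g R R' : Scheme.{u}) ⟶ (WK C hC hX g).left :=
  IsOpenImmersion.lift (chartWOpens C g hC hX).ι (transPK C hC hX g hg R R').left
    (range_transPK_subset C hC hX g hg R R')

/-- `t_{R,R'} ≫ W.ι = transPK`. [folklore] -/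
@[reassoc]
theorem trans_ι (R R' : Fin g → AlgPoints C K) :
    trans C hC hX g hg R R' ≫ (chartWOpens C g hC hX).ι = (transPK C hC hX g hg R R').left :=
  IsOpenImmersion.lift_fac _ _ _

/-- **The transition map as a `K`-morphism `V R R' → W`.** [folklore] -/
def transK (R R' : Fin g → AlgPoints C K) : VK C hC hX g R R' ⟶ WK C hC hX g :=
  Over.homMk (trans C hC hX g hg R R') (by
    show trans C hC hX g hg R R' ≫ (chartWOpens C g hC hX).ι ≫ (symPowProj C hC g).hom = _
    rw [trans_ι_assoc]
    exact Over.w (transPK C hC hX g hg R R'))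

/-- `(transK).left = trans`. [folklore] -/
@[simp]
theorem transK_left (R R' : Fin g → AlgPoints C K) : (transK C hC hX g hg R R').left = trans C hC hX g hg R R' := rfl

/-- `transK ≫ ιW = transPK`. [folklore] -/
@[reassoc (attr := simp)]
theorem transK_ιW (R R' : Fin g → AlgPoints C K) :
    transK C hC hX g hg R R' ≫ ιW C hC hX g = transPK C hC hX g hg R R' := by
  ext : 1
  exact trans_ι C hC hX g hg R R'

/-! ### The atlas axioms -/

omit [CharZero K] in
/-- **`V R R = W`**: `ℓ(Ê(E) − Σ[R] + Σ[R]) = ℓ(Ê(E)) = 1` on `W`. [folklore] -/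
theorem V_self (R : Fin g → AlgPoints C K) : V C hC hX g R R = ⊤ := by
  refine top_le_iff.mp fun x _ ↦ ?_
  have hle : chartWOpens C g hC hX ≤ transOpens C hC g R R :=
    le_opensOfAlgPoints fun z hz ↦ by
      rw [add_sub_cancel_right]
      exact ((pt_mem_chartW_iff C g hC z).mp hz).le
  exact hle x.2

include hg in
/-- **`t_{R,R} = id`** (as `K`-morphisms): `E` itself is the effective divisor linearly equivalent to `Ê(E)`. [folklore] -/
theorem transK_self (R : Fin g → AlgPoints C K) : transK C hC hX g hg R R = ιV C hC hX g R R := by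
  refine SchemeOver.hom_ext_of_forall_algPoints K fun x ↦ ?_
  apply comp_ιW_injective C hC hX g
  change (x ≫ transK C hC hX g hg R R) ≫ ιW C hC hX g = (x ≫ ιV C hC hX g R R) ≫ ιW C hC hX g
  rw [Category.assoc, transK_ιW, Category.assoc]
  obtain ⟨R₀, hR₀⟩ := exists_tuplePt_mk_eq C g hC (x ≫ ιV C hC hX g R R ≫ ιW C hC hX g)
  rw [← hR₀]
  apply transPK_spec
  rw [add_sub_cancel_right, ← hR₀, liftDiv_tuplePt_mk]
  exact Divisor.IsLinearlyEquivalent.refl' _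

include hg in
/-- `t_{R,R} = (V R R).ι` as morphisms of schemes. [folklore] -/
theorem trans_self (R : Fin g → AlgPoints C K) : trans C hC hX g hg R R = (V C hC hX g R R).ι :=
  congrArg CommaMorphism.left (transK_self C hC hX g hg R)

include hg in
/-- **`t_{R,R'}(V R R') ⊆ V R' R`**: `Ê(t E) − Σ[R'] + Σ[R] ∼ Ê(E)` has `ℓ = 1`. [folklore] -/
theorem trans_mem (R R' : Fin g → AlgPoints C K) (x : V C hC hX g R R') :
    trans C hC hX g hg R R' x ∈ V C hC hX g R' R := by
  change (chartWOpens C g hC hX).ι (trans C hC hX g hg R R' x) ∈ transOpens C hC g R' R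
  rw [← Scheme.Hom.comp_apply, trans_ι]
  refine forall_mem_of_forall_pt_mem (transPK C hC hX g hg R R') (transOpens C hC g R' R).isOpen (fun z ↦ ?_) x
  rw [SetLike.mem_coe, pt_mem_transOpens_iff C hC hX g]
  obtain ⟨hlin, -⟩ := liftDiv_transPK C hC hX g hg R R' z
  have key : (liftDiv C g hC (z ≫ transPK C hC hX g hg R R') + tupleDiv C R - tupleDiv C R').IsLinearlyEquivalent
      (liftDiv C g hC ((z ≫ ιV C hC hX g R R') ≫ ιW C hC hX g)) := by
    refine Divisor.IsLinearlyEquivalent.trans' (Divisor.IsLinearlyEquivalent.of_eq' (by abel))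
      (Divisor.IsLinearlyEquivalent.trans' (Divisor.IsLinearlyEquivalent.add_right' hlin (tupleDiv C R - tupleDiv C R')) (Divisor.IsLinearlyEquivalent.of_eq' ?_))
    rw [Category.assoc]; abel
  rw [Divisor.IsLinearlyEquivalent.ell_eq key]
  exact (ell_liftDiv_comp_ιW C hC hX g _).le

include hg in
/-- **The domain condition**: `E ∈ V R R'` and `t_{R,R'} E ∈ V R' R''` imply `E ∈ V R R''`
(`Ê(E) − Σ[R] + Σ[R''] ∼ Ê(t E) − Σ[R'] + Σ[R'']`). [folklore] -/
theorem trans_dom (R R' R'' : Fin g → AlgPoints C K) (x : V C hC hX g R R')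
    (hx : trans C hC hX g hg R R' x ∈ V C hC hX g R' R'') : x.1 ∈ V C hC hX g R R'' := by
  have hle : (V C hC hX g R R').ι ''ᵁ (trans C hC hX g hg R R' ⁻¹ᵁ V C hC hX g R' R'') ≤
      V C hC hX g R R'' := by
    refine Opens.le_of_forall_pt_mem (X := WK C hC hX g) fun z hz ↦ ?_
    obtain ⟨p, hp, hpz⟩ := hz
    have hzV : z.pt ∈ V C hC hX g R R' := by rw [← hpz]; exact p.2
    obtain ⟨x', hx'⟩ := exists_comp_ιV_eq C hC hX g R R' z hzV
    have hpt : x'.pt = p := by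
      rw [pt_eq_of_comp_ιV_eq C hC hX g R R' hx' hzV]
      exact Subtype.ext hpz.symm
    have hmem : AlgPoints.pt (x' ≫ transK C hC hX g hg R R') ∈ V C hC hX g R' R'' := by
      rw [AlgPoints.pt_comp, transK_left, hpt]; exact hp
    have h3 := (pt_mem_V_iff C hC hX g R' R'' _).mp hmem
    rw [Category.assoc, transK_ιW] at h3
    obtain ⟨hlin, -⟩ := liftDiv_transPK C hC hX g hg R R' x'
    rw [pt_mem_V_iff]
    have key : (liftDiv C g hC (x' ≫ transPK C hC hX g hg R R') + tupleDiv C R'' - tupleDiv C R').IsLinearlyEquivalent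
        (liftDiv C g hC (z ≫ ιW C hC hX g) + tupleDiv C R'' - tupleDiv C R) := by
      rw [← hx', Category.assoc]
      refine Divisor.IsLinearlyEquivalent.trans' (Divisor.IsLinearlyEquivalent.of_eq' (by abel))
        (Divisor.IsLinearlyEquivalent.trans' (Divisor.IsLinearlyEquivalent.add_right' hlin (tupleDiv C R'' - tupleDiv C R')) (Divisor.IsLinearlyEquivalent.of_eq' ?_))
      abel
    rw [← Divisor.IsLinearlyEquivalent.ell_eq key]
    exact h3
  exact hle ⟨x, hx, rfl⟩

include hg in
/-- **The cocycle `t_{R',R''} ∘ t_{R,R'} = t_{R,R''}`** (on any open of `W` where both sides are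
defined; both send `E` to the unique effective `E''` with `Ê(E'') ∼ Ê(E) − Σ[R] + Σ[R'']`,
unique because `ℓ(Ê(E'')) = 1`). [cite: Milne1986JacobianVarieties, §7 (Weil's construction)] -/
theorem trans_cocycle (Ri Rj Rk : Fin g → AlgPoints C K) (U : (WK C hC hX g).left.Opens)
    (a : (U : Scheme.{u}) ⟶ V C hC hX g Ri Rj) (b : (U : Scheme.{u}) ⟶ V C hC hX g Rj Rk)
    (c : (U : Scheme.{u}) ⟶ V C hC hX g Ri Rk) (h1 : a ≫ (V C hC hX g Ri Rj).ι = U.ι)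
    (h2 : b ≫ (V C hC hX g Rj Rk).ι = a ≫ trans C hC hX g hg Ri Rj)
    (h3 : c ≫ (V C hC hX g Ri Rk).ι = U.ι) :
    b ≫ trans C hC hX g hg Rj Rk = c ≫ trans C hC hX g hg Ri Rk := by
  let UK : SchemeOver K := overMk (U.ι ≫ (WK C hC hX g).hom)
  haveI : LocallyOfFiniteType UK.hom := show LocallyOfFiniteType (U.ι ≫ (WK C hC hX g).hom) from inferInstance
  haveI : IsReduced UK.left := show IsReduced (U : Scheme.{u}) from inferInstance
  have hVK : ∀ R R' : Fin g → AlgPoints C K,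
      trans C hC hX g hg R R' ≫ (WK C hC hX g).hom = (V C hC hX g R R').ι ≫ (WK C hC hX g).hom :=
    fun R R' ↦ Over.w (transK C hC hX g hg R R')
  let aK : UK ⟶ VK C hC hX g Ri Rj := Over.homMk a (by
    show a ≫ (V C hC hX g Ri Rj).ι ≫ (WK C hC hX g).hom = U.ι ≫ (WK C hC hX g).hom
    rw [← Category.assoc, h1])
  let bK : UK ⟶ VK C hC hX g Rj Rk := Over.homMk b (by
    show b ≫ (V C hC hX g Rj Rk).ι ≫ (WK C hC hX g).hom = U.ι ≫ (WK C hC hX g).hom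
    rw [← Category.assoc, h2, Category.assoc, hVK, ← Category.assoc, h1])
  let cK : UK ⟶ VK C hC hX g Ri Rk := Over.homMk c (by
    show c ≫ (V C hC hX g Ri Rk).ι ≫ (WK C hC hX g).hom = U.ι ≫ (WK C hC hX g).hom
    rw [← Category.assoc, h3])
  have hb' : bK ≫ ιV C hC hX g Rj Rk = aK ≫ transK C hC hX g hg Ri Rj := by ext : 1; exact h2
  have hc' : cK ≫ ιV C hC hX g Ri Rk = aK ≫ ιV C hC hX g Ri Rj := by ext : 1; exact h3.trans h1.symm
  have key : bK ≫ transK C hC hX g hg Rj Rk = cK ≫ transK C hC hX g hg Ri Rk := by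
    refine SchemeOver.hom_ext_of_forall_algPoints K fun x ↦ ?_
    apply comp_ιW_injective C hC hX g
    change (x ≫ bK ≫ transK C hC hX g hg Rj Rk) ≫ ιW C hC hX g = (x ≫ cK ≫ transK C hC hX g hg Ri Rk) ≫ ιW C hC hX g
    simp only [Category.assoc, transK_ιW]
    rw [← Category.assoc x bK, ← Category.assoc x cK]
    obtain ⟨hb, hb1⟩ := liftDiv_transPK C hC hX g hg Rj Rk (x ≫ bK)
    obtain ⟨hc, -⟩ := liftDiv_transPK C hC hX g hg Ri Rk (x ≫ cK)
    obtain ⟨ha, -⟩ := liftDiv_transPK C hC hX g hg Ri Rj (x ≫ aK)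
    have e2 : (x ≫ bK) ≫ ιV C hC hX g Rj Rk ≫ ιW C hC hX g = (x ≫ aK) ≫ transPK C hC hX g hg Ri Rj := by
      rw [Category.assoc, ← Category.assoc bK, hb']
      simp only [Category.assoc, transK_ιW]
    have e1 : (x ≫ cK) ≫ ιV C hC hX g Ri Rk ≫ ιW C hC hX g = (x ≫ aK) ≫ ιV C hC hX g Ri Rj ≫ ιW C hC hX g := by
      rw [Category.assoc, ← Category.assoc cK, hc']
      simp only [Category.assoc]
    rw [e2] at hb
    rw [e1] at hc
    refine symPowProj.algPoints_eq_of_isLinearlyEquivalent C hC g ?_ hb1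
    -- `Ê y₁ ∼ Ê(t_ij E) + Rk − Rj ∼ (Ê E + Rj − Ri) + Rk − Rj = Ê E + Rk − Ri ∼ Ê y₂`
    refine Divisor.IsLinearlyEquivalent.trans' hb (Divisor.IsLinearlyEquivalent.trans' (Divisor.IsLinearlyEquivalent.trans' (Divisor.IsLinearlyEquivalent.of_eq' (by abel))
      (Divisor.IsLinearlyEquivalent.trans' (Divisor.IsLinearlyEquivalent.add_right' ha (tupleDiv C Rk - tupleDiv C Rj)) (Divisor.IsLinearlyEquivalent.of_eq' ?_)))
      (Divisor.IsLinearlyEquivalent.symm' hc))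
    abel
  exact congrArg CommaMorphism.left key

/-! ### The glued scheme `J` and its charts -/

/-- The transitions are morphisms over `K`. [folklore] -/
theorem trans_over (R R' : Fin g → AlgPoints C K) :
    trans C hC hX g hg R R' ≫ (WK C hC hX g).hom = (V C hC hX g R R').ι ≫ (WK C hC hX g).hom :=
  Over.w (transK C hC hX g hg R R')

/-- **Weil's atlas on the chart `W`**: indices the `g`-tuples `R` of `K`-points of `C` (chart `R`
is `E ↦ [E − Σ[R]]`), opens `V R R'`, transitions `t_{R,R'}`. [cite: Milne1986JacobianVarieties, §7 (proof of Thm. 7.1)] -/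
abbrev atlas : TransitionAtlas (WK C hC hX g).left where
  ι := Fin g → AlgPoints C K
  V := V C hC hX g
  t := trans C hC hX g hg
  V_self := V_self C hC hX g
  t_self := trans_self C hC hX g hg
  t_mem := trans_mem C hC hX g hg
  dom := trans_dom C hC hX g hg
  cocycle := trans_cocycle C hC hX g hg

/-- **The Jacobian of `C` as a scheme: Weil's gluing of the copies `W_R` of `W`.** [cite: Milne1986JacobianVarieties, §7 Thm. 7.1 (proof)] -/
abbrev J : Scheme.{u} := (atlas C hC hX g hg).glued

/-- The structure map `J → Spec K`. [folklore] -/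
def Jbase : J C hC hX g hg ⟶ Spec (.of K) :=
  (atlas C hC hX g hg).toBase (WK C hC hX g).hom (trans_over C hC hX g hg)

/-- **The Jacobian as a `K`-scheme.** [cite: Milne1986JacobianVarieties, §7 Thm. 7.1] -/
abbrev JK : SchemeOver K := overMk (Jbase C hC hX g hg)

/-- **The chart `ι_R : W ↪ J`, `E ↦ [E − Σ[R]]`.** [cite: Milne1986JacobianVarieties, §7 (proof of Thm. 7.1)] -/
def chart (R : Fin g → AlgPoints C K) : WK C hC hX g ⟶ JK C hC hX g hg :=
  Over.homMk ((atlas C hC hX g hg).chart R)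
    ((atlas C hC hX g hg).chart_toBase (WK C hC hX g).hom (trans_over C hC hX g hg) R)

/-- `(chart R).left` is the chart of the atlas. [folklore] -/
@[simp]
theorem chart_left (R : Fin g → AlgPoints C K) : (chart C hC hX g hg R).left = (atlas C hC hX g hg).chart R := rfl

/-- The charts are open immersions. [folklore] -/
instance isOpenImmersion_chart_left (R : Fin g → AlgPoints C K) : IsOpenImmersion (chart C hC hX g hg R).left :=
  inferInstanceAs (IsOpenImmersion ((atlas C hC hX g hg).chart R))

/-- `J → Spec K` is locally of finite type. [folklore] -/
instance locallyOfFiniteType_JK_hom : LocallyOfFiniteType (JK C hC hX g hg).hom :=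
  (atlas C hC hX g hg).locallyOfFiniteType_toBase (WK C hC hX g).hom (trans_over C hC hX g hg)

/-- `J` is reduced. [folklore] -/
instance isReduced_JK_left : IsReduced (JK C hC hX g hg).left := (atlas C hC hX g hg).isReduced_glued

/-- **Every `K`-point of `J` is `[E − Σ[R]]` for some chart `R` and `E ∈ W(K)`.** [folklore] -/
theorem exists_comp_chart_eq (z : AlgPoints (JK C hC hX g hg) K) :
    ∃ (R : Fin g → AlgPoints C K) (x : AlgPoints (WK C hC hX g) K), x ≫ chart C hC hX g hg R = z := by
  obtain ⟨R, p, hp⟩ := (atlas C hC hX g hg).exists_chart_apply_eq z.pt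
  obtain ⟨x, hx⟩ := AlgPoints.exists_comp_eq_of_mem_range (chart C hC hX g hg R) z ⟨p, hp⟩
  exact ⟨R, x, hx⟩

include hg in
/-- **When two chart points coincide in `J(K)`**: `[E − Σ[R]] = [E' − Σ[R']]` iff
`Ê(E) − Σ[R] ∼ Ê(E') − Σ[R']`. [cite: Milne1986JacobianVarieties, §7 (proof of Thm. 7.1)] -/
theorem comp_chart_eq_iff (R R' : Fin g → AlgPoints C K) (x y : AlgPoints (WK C hC hX g) K) :
    x ≫ chart C hC hX g hg R = y ≫ chart C hC hX g hg R' ↔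
      (liftDiv C g hC (x ≫ ιW C hC hX g) - tupleDiv C R).IsLinearlyEquivalent
        (liftDiv C g hC (y ≫ ιW C hC hX g) - tupleDiv C R') := by
  constructor
  · intro h
    have hpt : (atlas C hC hX g hg).chart R x.pt = (atlas C hC hX g hg).chart R' y.pt := by
      rw [← chart_left, ← AlgPoints.pt_comp, h, AlgPoints.pt_comp, chart_left]
    obtain ⟨hxV, hty⟩ := ((atlas C hC hX g hg).chart_eq_chart_iff R R' x.pt y.pt).mp hpt
    obtain ⟨x', hx'⟩ := exists_comp_ιV_eq C hC hX g R R' x hxV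
    have hpt' := pt_eq_of_comp_ιV_eq C hC hX g R R' hx' hxV
    have hy : x' ≫ transK C hC hX g hg R R' = y := by
      apply AlgPoints.eq_of_pt_eq
      rw [AlgPoints.pt_comp, transK_left, hpt']
      exact hty
    obtain ⟨hlin, -⟩ := liftDiv_transPK C hC hX g hg R R' x'
    rw [← transK_ιW, ← Category.assoc x' (transK C hC hX g hg R R') (ιW C hC hX g), hy,
      ← Category.assoc x' (ιV C hC hX g R R') (ιW C hC hX g), hx'] at hlin
    -- `Ê y ∼ Ê x + R' − R`, so `Ê x − R ∼ Ê y − R'`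
    exact Divisor.IsLinearlyEquivalent.trans' (Divisor.IsLinearlyEquivalent.of_eq' (by abel)) (Divisor.IsLinearlyEquivalent.trans'
      (Divisor.IsLinearlyEquivalent.add_right' (Divisor.IsLinearlyEquivalent.symm' hlin) (-tupleDiv C R')) (Divisor.IsLinearlyEquivalent.of_eq' (by abel)))
  · intro h
    -- `x ∈ V R R'` since `ℓ(Ê x − R + R') = ℓ(Ê y) = 1`
    have h1 : (liftDiv C g hC (x ≫ ιW C hC hX g) + tupleDiv C R' - tupleDiv C R).IsLinearlyEquivalent
        (liftDiv C g hC (y ≫ ιW C hC hX g)) :=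
      Divisor.IsLinearlyEquivalent.trans' (Divisor.IsLinearlyEquivalent.of_eq' (by abel))
        (Divisor.IsLinearlyEquivalent.trans' (Divisor.IsLinearlyEquivalent.add_right' h (tupleDiv C R')) (Divisor.IsLinearlyEquivalent.of_eq' (by abel)))
    have hxV : x.pt ∈ V C hC hX g R R' := by
      rw [pt_mem_V_iff, Divisor.IsLinearlyEquivalent.ell_eq h1]
      exact (ell_liftDiv_comp_ιW C hC hX g y).le
    obtain ⟨x', hx'⟩ := exists_comp_ιV_eq C hC hX g R R' x hxV
    obtain ⟨R₀, hR₀⟩ := exists_tuplePt_mk_eq C g hC (y ≫ ιW C hC hX g)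
    have hspec := transPK_spec C hC hX g hg R R' x' R₀ (by
      rw [← Category.assoc, hx', ← liftDiv_tuplePt_mk C g hC R₀, hR₀]; exact Divisor.IsLinearlyEquivalent.symm' h1)
    rw [hR₀, ← transK_ιW, ← Category.assoc] at hspec
    have hy : x' ≫ transK C hC hX g hg R R' = y := comp_ιW_injective C hC hX g hspec
    have hpt' := pt_eq_of_comp_ιV_eq C hC hX g R R' hx' hxV
    apply AlgPoints.eq_of_pt_eq
    rw [AlgPoints.pt_comp, AlgPoints.pt_comp, chart_left, chart_left]
    refine ((atlas C hC hX g hg).chart_eq_chart_iff R R' x.pt y.pt).mpr ⟨hxV, ?_⟩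
    rw [← hy, AlgPoints.pt_comp, transK_left, hpt']

/-! ### Separatedness: the graphs of the transitions are closed in `W ×_K W` -/

/-- The graph `E ↦ (E, t_{R,R'} E)` as a `K`-morphism `V R R' → W ×_K W`. [folklore] -/
def graphK (R R' : Fin g → AlgPoints C K) : VK C hC hX g R R' ⟶ WK C hC hX g ⊗ WK C hC hX g :=
  lift (ιV C hC hX g R R') (transK C hC hX g hg R R')

/-- `(graphK).left` is the graph of the atlas. [folklore] -/
theorem graphK_left (R R' : Fin g → AlgPoints C K) :
    (graphK C hC hX g hg R R').left = (atlas C hC hX g hg).graph (WK C hC hX g).hom (trans_over C hC hX g hg) R R' :=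
  rfl

/-- The graph factors as the closed immersion `V R R' → V R R' ×_K W` (graph of `t_{R,R'}` over
`K`) followed by the open immersion `V R R' ×_K W → W ×_K W`. [folklore] -/
theorem graph_eq (R R' : Fin g → AlgPoints C K) :
    (atlas C hC hX g hg).graph (WK C hC hX g).hom (trans_over C hC hX g hg) R R' =
      pullback.lift (𝟙 _) (trans C hC hX g hg R R')
          (Category.id_comp (trans C hC hX g hg R R' ≫ (WK C hC hX g).hom)) ≫
        pullback.map (trans C hC hX g hg R R' ≫ (WK C hC hX g).hom) (WK C hC hX g).hom (WK C hC hX g).hom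
          (WK C hC hX g).hom (V C hC hX g R R').ι (𝟙 _) (𝟙 _)
          ((Category.comp_id _).trans (trans_over C hC hX g hg R R'))
          ((Category.comp_id _).trans (Category.id_comp _).symm) := by
  apply pullback.hom_ext
  · erw [pullback.lift_fst]
    erw [Category.assoc, pullback.lift_fst, pullback.lift_fst_assoc, Category.id_comp]
  · erw [pullback.lift_snd]
    erw [Category.assoc, pullback.lift_snd, pullback.lift_snd_assoc, Category.comp_id]

include hg in
/-- **`K`-points of the graph of `t_{R,R'}`**: `(E, E')` lies on it iff
`ℓ(Ê(E) − Ê(E') − Σ[R] + Σ[R']) ≥ 1` (iff this degree-`0` divisor is principal). [cite: Milne1986JacobianVarieties, §7 (proof of Thm. 7.1)] -/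
theorem exists_comp_graphK_eq_iff (R R' : Fin g → AlgPoints C K) (x y : AlgPoints (WK C hC hX g) K) :
    (∃ x' : AlgPoints (VK C hC hX g R R') K, x' ≫ graphK C hC hX g hg R R' = lift x y) ↔
      1 ≤ ell (liftDiv C g hC (x ≫ ιW C hC hX g) - liftDiv C g hC (y ≫ ιW C hC hX g) + tupleDiv C R' - tupleDiv C R) := by
  constructor
  · rintro ⟨x', hx'⟩
    have h1 : x' ≫ ιV C hC hX g R R' = x := by
      have := congrArg (· ≫ fst _ _) hx'
      simpa only [graphK, Category.assoc, lift_fst] using this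
    have h2 : x' ≫ transK C hC hX g hg R R' = y := by
      have := congrArg (· ≫ snd _ _) hx'
      simpa only [graphK, Category.assoc, lift_snd] using this
    obtain ⟨hlin, -⟩ := liftDiv_transPK C hC hX g hg R R' x'
    rw [← transK_ιW, ← Category.assoc x' (transK C hC hX g hg R R') (ιW C hC hX g), h2,
      ← Category.assoc x' (ιV C hC hX g R R') (ιW C hC hX g), h1] at hlin
    -- `Ê y ∼ Ê x + R' − R`, so `Ê x − Ê y + R' − R ∼ 0` has `ℓ = ℓ(0) = 1`
    have hP : (liftDiv C g hC (x ≫ ιW C hC hX g) - liftDiv C g hC (y ≫ ιW C hC hX g) + tupleDiv C R' -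
        tupleDiv C R).IsLinearlyEquivalent 0 := by
      change Divisor.IsPrincipal _
      have e : liftDiv C g hC (x ≫ ιW C hC hX g) - liftDiv C g hC (y ≫ ιW C hC hX g) + tupleDiv C R' -
          tupleDiv C R - 0 = liftDiv C g hC (x ≫ ιW C hC hX g) + tupleDiv C R' - tupleDiv C R -
            liftDiv C g hC (y ≫ ιW C hC hX g) := by abel
      rw [e]; exact Divisor.IsLinearlyEquivalent.symm' hlin
    have h0 := Divisor.ell_sub_ne_zero_of_isLinearlyEquivalent (Divisor.IsLinearlyEquivalent.symm' hP)
    rw [sub_zero] at h0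
    exact Nat.one_le_iff_ne_zero.mpr h0
  · intro h
    have hdeg : (liftDiv C g hC (x ≫ ιW C hC hX g) - liftDiv C g hC (y ≫ ιW C hC hX g) + tupleDiv C R' - tupleDiv C R).degree = 0 := by
      rw [map_sub, map_add, map_sub, degree_liftDiv, degree_liftDiv, degree_tupleDiv, degree_tupleDiv]; ring
    have hpr := Divisor.isPrincipal_of_degree_eq_zero_of_ell_ne_zero hdeg (Nat.one_le_iff_ne_zero.mp h)
    have hlin : (liftDiv C g hC (x ≫ ιW C hC hX g) + tupleDiv C R' - tupleDiv C R).IsLinearlyEquivalent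
        (liftDiv C g hC (y ≫ ιW C hC hX g)) := by
      change Divisor.IsPrincipal _
      have e : liftDiv C g hC (x ≫ ιW C hC hX g) + tupleDiv C R' - tupleDiv C R - liftDiv C g hC (y ≫ ιW C hC hX g) =
          liftDiv C g hC (x ≫ ιW C hC hX g) - liftDiv C g hC (y ≫ ιW C hC hX g) + tupleDiv C R' - tupleDiv C R := by abel
      rw [e]; exact hpr
    have hxV : x.pt ∈ V C hC hX g R R' := by
      rw [pt_mem_V_iff, Divisor.IsLinearlyEquivalent.ell_eq hlin]
      exact (ell_liftDiv_comp_ιW C hC hX g y).le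
    obtain ⟨x', hx'⟩ := exists_comp_ιV_eq C hC hX g R R' x hxV
    obtain ⟨R₀, hR₀⟩ := exists_tuplePt_mk_eq C g hC (y ≫ ιW C hC hX g)
    have hspec := transPK_spec C hC hX g hg R R' x' R₀ (by
      rw [← Category.assoc, hx', ← liftDiv_tuplePt_mk C g hC R₀, hR₀]; exact Divisor.IsLinearlyEquivalent.symm' hlin)
    rw [hR₀, ← transK_ιW, ← Category.assoc] at hspec
    have hy : x' ≫ transK C hC hX g hg R R' = y := comp_ιW_injective C hC hX g hspec
    refine ⟨x', ?_⟩
    apply CartesianMonoidalCategory.hom_ext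
    · rw [graphK, Category.assoc, lift_fst, lift_fst, hx']
    · rw [graphK, Category.assoc, lift_snd, lift_snd, hy]

include hg in
/-- **The graph of `t_{R,R'}` is closed in `W ×_K W`**: it is locally closed (a closed immersion
into `V R R' ×_K W`, open in `W ×_K W`), and it has the same closed points as the preimage of the
closed set `{ℓ(Ê(y₁) − Ê(y₂) − Σ[R] + Σ[R']) ≥ 1}` of `C⁽ᵍ⁾ ×_K C⁽ᵍ⁾` (semicontinuity). [cite: Milne1986JacobianVarieties, §7 (proof of Thm. 7.1: `J` is separated)] -/
theorem isClosed_range_graph (R R' : Fin g → AlgPoints C K) :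
    IsClosed (Set.range ((atlas C hC hX g hg).graph (WK C hC hX g).hom (trans_over C hC hX g hg) R R')) := by
  haveI := symPowProj.locallyOfFiniteType_hom C hC g
  haveI : JacobsonSpace ↥(WK C hC hX g ⊗ WK C hC hX g).left :=
    LocallyOfFiniteType.jacobsonSpace (WK C hC hX g ⊗ WK C hC hX g).hom
  rw [← graphK_left]
  -- (1) the range of the graph is locally closed
  have hL : IsLocallyClosed (Set.range (graphK C hC hX g hg R R').left) := by
    rw [graphK_left, graph_eq]
    have key : ∀ {A B : Scheme.{u}} (γ : (V C hC hX g R R' : Scheme.{u}) ⟶ A) (o : A ⟶ B),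
        IsClosedImmersion γ → IsOpenImmersion o → IsLocallyClosed (Set.range (γ ≫ o)) := by
      intro A B γ o _ _
      have hr : Set.range (γ ≫ o) = o '' Set.range γ := by
        ext x
        simp only [Set.mem_range, Set.mem_image, Scheme.Hom.comp_apply, exists_exists_eq_and]
      rw [hr]
      exact isLocallyClosed_image_of_isOpenEmbedding o.isOpenEmbedding γ.isClosedEmbedding.isClosed_range
    exact key _ _ inferInstance (MorphismProperty.pullbackMap (P := @IsOpenImmersion) inferInstance inferInstance
      (trans_over C hC hX g hg R R') (Category.id_comp _).symm)
  -- (2) the closed set from semicontinuity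
  obtain ⟨U₀, hU₀⟩ := exists_opens_tensor_symPowProj_pt_mem_iff_sub C hC hX g 0 R' R
  let m : WK C hC hX g ⊗ WK C hC hX g ⟶ symPowProj C hC g ⊗ symPowProj C hC g :=
    ιW C hC hX g ⊗ₘ ιW C hC hX g
  have hM : IsClosed (m.left ⁻¹' (U₀ : Set (symPowProj C hC g ⊗ symPowProj C hC g).left)ᶜ) :=
    (U₀.2.isClosed_compl).preimage m.left.continuous
  -- the two sets have the same `K`-points
  have hval : ∀ ζ : AlgPoints (WK C hC hX g ⊗ WK C hC hX g) K,
      AlgPoints.pt ζ ∈ m.left ⁻¹' (U₀ : Set (symPowProj C hC g ⊗ symPowProj C hC g).left)ᶜ ↔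
        1 ≤ ell (liftDiv C g hC ((ζ ≫ fst _ _) ≫ ιW C hC hX g) - liftDiv C g hC ((ζ ≫ snd _ _) ≫ ιW C hC hX g) +
          tupleDiv C R' - tupleDiv C R) := by
    intro ζ
    obtain ⟨Rx, hRx⟩ := exists_tuplePt_mk_eq C g hC ((ζ ≫ fst _ _) ≫ ιW C hC hX g)
    obtain ⟨Ry, hRy⟩ := exists_tuplePt_mk_eq C g hC ((ζ ≫ snd _ _) ≫ ιW C hC hX g)
    have hζm : ζ ≫ m = lift (tuplePt C (strPt (K := K) K) Rx ≫ symPowProj.mk C hC g)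
        (tuplePt C (strPt (K := K) K) Ry ≫ symPowProj.mk C hC g) := by
      apply CartesianMonoidalCategory.hom_ext
      · rw [lift_fst, hRx]
        simp only [Category.assoc]
        exact congrArg (ζ ≫ ·) (tensorHom_fst _ _)
      · rw [lift_snd, hRy]
        simp only [Category.assoc]
        exact congrArg (ζ ≫ ·) (tensorHom_snd _ _)
    rw [Set.mem_preimage, ← AlgPoints.pt_comp, hζm, Set.mem_compl_iff, SetLike.mem_coe, hU₀ Rx Ry,
      ← liftDiv_tuplePt_mk C g hC Rx, ← liftDiv_tuplePt_mk C g hC Ry, hRx, hRy]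
    omega
  -- (3) compare closed points
  refine (eq_of_isLocallyClosed_of_isClosed_of_closedPoints hL hM fun p hp ↦ ?_) ▸ hM
  obtain ⟨ζ, rfl⟩ := AlgPoints.exists_pt_eq_of_isClosed_singleton (X := WK C hC hX g ⊗ WK C hC hX g) hp
  have hζ : lift (ζ ≫ fst _ _) (ζ ≫ snd _ _) = ζ := by
    apply CartesianMonoidalCategory.hom_ext <;> simp only [lift_fst, lift_snd]
  have key := exists_comp_graphK_eq_iff C hC hX g hg R R' (ζ ≫ fst _ _) (ζ ≫ snd _ _)
  rw [hζ] at key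
  rw [hval ζ, ← key]
  constructor
  · rintro ⟨v, hv⟩
    have h1 : (graphK C hC hX g hg R R').left ≫ (fst (WK C hC hX g) (WK C hC hX g)).left = (V C hC hX g R R').ι :=
      congrArg CommaMorphism.left (lift_fst (ιV C hC hX g R R') (transK C hC hX g hg R R'))
    have hvx : (V C hC hX g R R').ι v = AlgPoints.pt (ζ ≫ fst _ _) := by
      rw [AlgPoints.pt_comp, ← hv, ← Scheme.Hom.comp_apply, h1]
    have hzV : AlgPoints.pt (ζ ≫ fst _ _) ∈ V C hC hX g R R' := by rw [← hvx]; exact v.2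
    obtain ⟨x', hx'⟩ := exists_comp_ιV_eq C hC hX g R R' (ζ ≫ fst _ _) hzV
    have hpt : x'.pt = v := by
      rw [pt_eq_of_comp_ιV_eq C hC hX g R R' hx' hzV]
      exact Subtype.ext hvx.symm
    exact ⟨x', AlgPoints.eq_of_pt_eq (by rw [AlgPoints.pt_comp, hpt]; exact hv)⟩
  · rintro ⟨x', hx'⟩
    exact ⟨x'.pt, by rw [← AlgPoints.pt_comp, hx']⟩

include hg in
/-- **`J` is separated over `K`.** [cite: Milne1986JacobianVarieties, §7 Thm. 7.1 (proof)] -/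
theorem isSeparated_Jbase : IsSeparated (Jbase C hC hX g hg) :=
  (atlas C hC hX g hg).isSeparated_toBase _ _ (isClosed_range_graph C hC hX g hg)

/-- `J → Spec K` is separated. [folklore] -/
instance isSeparated_JK_hom : IsSeparated (JK C hC hX g hg).hom := isSeparated_Jbase C hC hX g hg

end WeilJacobian

end Literature.AlgebraicGeometry.Motives

end
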